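import Literature.AlgebraicGeometry.Resolution.CompletionBaseChange
import Mathlib.RingTheory.AdicCompletion.LocalRing
import Mathlib.RingTheory.Ideal.Quotient.Operations
import HarnessLib

/-!
# Crux `Steer` (stmt-ResolutionOfSingularities-16345), chain W4.1: «`f` IS A `p`-TH POWER MODULO `𝔪^M`» DESCENDS FROM THE
# COMPLETION (the algebraic-local-ring form of order raising; Theses-free, definition-free)

OURS (campaign `res-hironaka`, rung L ★L-G4, slot W4.1; seat res-D-pv-004 AS res-L0-w41-stub-10; replaces the role of
no printed item and is NOT a statement of the manuscript under review [claim: Hironaka2017, status: under-review];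
AI-produced, weaker than expert review). Companion of `FrobeniusClosingSteerPthPowerOrderRaising.lean` (order raising by
a `p`-th power in the Cohen model `κ⟦X⟧`) answering res-L0-w41-plan-1 RULING ×6 (4) «… + its algebraic-local-ring form
via completion» and res-type-096's B4 (β) step «`N(f) ∈ 𝔫⁵` in `R̂` ⇒ `∃ ĝ ∈ R i, f − ĝ² ∈ 𝔪⁵`» (HOME/STATUS 07:59:27Z):
for a Noetherian local ring `R` with completion `R̂ = (R, 𝔪)^` (`𝔪R̂ = 𝔪̂`, `R/𝔪^M = R̂/𝔪̂^M`, Stacks 05GG, tree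
`quotientMap_pow_bijective_adicCompletion`):

* `mem_maximalIdeal_pow_iff_adicCompletion` — `x ∈ 𝔪^M ↔ x ∈ 𝔪̂^M` for `x ∈ R`;
* `exists_sub_algebraMap_mem_pow` — every `y ∈ R̂` is `≡` some `a ∈ R` modulo `𝔪̂^M`;
* **`exists_sub_pow_mem_pow_of_adicCompletion`** — `f − ĝ^p ∈ 𝔪̂^M` for some `ĝ ∈ R̂` ⇒ `f − g^p ∈ 𝔪^M` for some `g ∈ R`
  (any exponent `p`, any characteristic); `sub_pow_mem_pow_iff_adicCompletion` — the case `ĝ = g ∈ R`.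

[cite: StacksProject, Tag 05GG] bears_on: LADDER-RESOLUTION L ★L-G4 W4.1 (crux `Steer`, σ-residual HIGH steps B4/B4′).
-/

noncomputable section

set_option linter.dupNamespace false

open IsLocalRing

namespace Summit.ResolutionOfSingularities.ResolutionOfSingularities.Theorems.SwitchingDichotomy.CompletionTransfer

open Literature.AlgebraicGeometry.Resolution

universe u

variable {R : Type u} [CommRing R] [IsLocalRing R] [IsNoetherianRing R]

/-- `𝔪^M ∩ R = 𝔪^M` for the completion: membership in a power of the maximal ideal is detected in `R̂` (Stacks 05GG,
tree `quotientMap_pow_bijective_adicCompletion`). [cite: StacksProject, Tag 05GG] -/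
theorem mem_maximalIdeal_pow_iff_adicCompletion (x : R) (M : ℕ) :
    x ∈ maximalIdeal R ^ M ↔
      algebraMap R (AdicCompletion (maximalIdeal R) R) x ∈ maximalIdeal (AdicCompletion (maximalIdeal R) R) ^ M := by
  rw [AdicCompletion.maximalIdeal_eq_map, ← Ideal.map_pow]
  constructor
  · exact fun h => Ideal.mem_map_of_mem _ h
  · exact (quotientMap_injective_iff_forall _ _).1
      (quotientMap_pow_bijective_adicCompletion (maximalIdeal R) (maximalIdeal R).fg_of_isNoetherianRing M).1 x

/-- Every element of `R̂` is congruent to an element of `R` modulo `𝔪̂^M`. [cite: StacksProject, Tag 05GG] -/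
theorem exists_sub_algebraMap_mem_pow (y : AdicCompletion (maximalIdeal R) R) (M : ℕ) :
    ∃ a : R, y - algebraMap R _ a ∈ maximalIdeal (AdicCompletion (maximalIdeal R) R) ^ M := by
  rw [AdicCompletion.maximalIdeal_eq_map, ← Ideal.map_pow]
  exact (quotientMap_surjective_iff_forall _ _).1
    (quotientMap_pow_bijective_adicCompletion (maximalIdeal R) (maximalIdeal R).fg_of_isNoetherianRing M).2 y

/-- **Descent of «`f` is a `p`-th power modulo `𝔪^M`» from the completion** (the «algebraic local ring form via
completion» of res-L0-w41-plan-1 RULING ×6 (4)): if `f − ĝ^p ∈ 𝔪̂^M` for some `ĝ ∈ R̂`, then `f − g^p ∈ 𝔪^M` for some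
`g ∈ R` — take `g ≡ ĝ (mod 𝔪̂^M)` (`R/𝔪^M = R̂/𝔪̂^M`). Any exponent `p`, any Noetherian local `R`. OURS.
[cite: StacksProject, Tag 05GG] -/
theorem exists_sub_pow_mem_pow_of_adicCompletion (f : R) (p M : ℕ) (ĝ : AdicCompletion (maximalIdeal R) R)
    (h : algebraMap R _ f - ĝ ^ p ∈ maximalIdeal (AdicCompletion (maximalIdeal R) R) ^ M) :
    ∃ g : R, f - g ^ p ∈ maximalIdeal R ^ M := by
  obtain ⟨g, hg⟩ := exists_sub_algebraMap_mem_pow ĝ M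
  refine ⟨g, (mem_maximalIdeal_pow_iff_adicCompletion _ M).2 ?_⟩
  have hpow : ĝ ^ p - (algebraMap R (AdicCompletion (maximalIdeal R) R) g) ^ p ∈
      maximalIdeal (AdicCompletion (maximalIdeal R) R) ^ M :=
    Ideal.mem_of_dvd _ (sub_dvd_pow_sub_pow ĝ _ p) hg
  have : algebraMap R _ (f - g ^ p) = (algebraMap R _ f - ĝ ^ p) + (ĝ ^ p - (algebraMap R _ g) ^ p) := by
    rw [map_sub, map_pow]; ring
  rw [this]
  exact Ideal.add_mem _ h hpow

/-- Conversely, `f − g^p ∈ 𝔪^M` in `R` iff in `R̂`. OURS. [cite: StacksProject, Tag 05GG] -/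
theorem sub_pow_mem_pow_iff_adicCompletion (f g : R) (p M : ℕ) :
    f - g ^ p ∈ maximalIdeal R ^ M ↔
      algebraMap R (AdicCompletion (maximalIdeal R) R) f - (algebraMap R _ g) ^ p ∈
        maximalIdeal (AdicCompletion (maximalIdeal R) R) ^ M := by
  rw [mem_maximalIdeal_pow_iff_adicCompletion, map_sub, map_pow]

end Summit.ResolutionOfSingularities.ResolutionOfSingularities.Theorems.SwitchingDichotomy.CompletionTransfer

end
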